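import Summits.ResolutionOfSingularities.ResolutionOfSingularities.Theorems.PurelyInseparableDim4PointTreeWalk
import HarnessLib

/-!
# Purely inseparable four-folds: a NON-VACUITY CERTIFICATE for the point tree — the four-fold double point
# `z² + x₁x₂ + x₃x₄` in characteristic `2` admits a marked resolution (brick TY-3k part 8 «QUADRIC», cell `res-dim4-pi`)

[OURS · counted 0] (D-0157 DOOR 2; an unconditional instance of the conclusion of `PIDim4.OrderReduction 2` obtained
through the walk-form theorem `Equimultiple.exists_isMarkedResolution_of_walk`; host item stmt-ResolutionOfSingularities-16155,
helper). Resolution of singularities in dimension ≥ 4 / characteristic `p` is NOT proved here or anywhere in this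
programme; this file resolves ONE quadric cone, whose resolution by one point blow-up is classical.

`F = x₁x₂ + x₃x₄ ∈ K[x₁, …, x₄]`, `K = K̄` of characteristic `2`: `F` is clean and non-zero; the only root parameter
is `b = 0` (the linear part of `F(x + b)` is `b₂x₁ + b₁x₂ + b₄x₃ + b₃x₄`); in every chart `x_j` of the blow-up of the
origin the chart transform is `x_{j'} + (the other product)` with a surviving LINEAR monomial, so NO point of the
exceptional divisor is equimultiple: the MODE-0 walk from `(F, 0, ∅)` has no edge (well-founded, finitely branching).

* `coeff_single_translate_linear_add_mul`, `chartTransform_two_X_mul_X`, `chartTransform_quadric`, `roots_quadric_subset`,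
  `isClean_quadric`, `quadric_ne_zero` — the computations;
* `not_isEquimultiplePoint_quadric` — no equimultiple point above the origin, in any chart;
* **`exists_isMarkedResolution_quadric`** — `∃ X′ π M′, IsMarkedResolution ⟨hypSheaf 2 (x₁x₂ + x₃x₄), [], 2⟩ π M′`.

AI-produced formalisation, weaker than expert review. bears_on: LADDER-RESOLUTION:D157-DOOR2 (res-dim4-pi · TY-3k).
-/

set_option linter.dupNamespace false -- D-0017: single-problem summit path `Summit.<S>.<S>.…` by design

noncomputable section

open MvPolynomial Finset CategoryTheory AlgebraicGeometry Opposite TopologicalSpace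

namespace Summit.ResolutionOfSingularities.ResolutionOfSingularities.Theorems.PIDim4

open Literature.AlgebraicGeometry.Resolution
open Literature.AlgebraicGeometry.Resolution.Hauser2010
open Literature.AlgebraicGeometry.Resolution.AffinePointBlowup (P A γ coord Wtop ξ)

namespace Equimultiple

section Quadric

variable {K : Type} [Field K]

/-! ## 1. Polynomial computations -/

/-- `x_a x_c` as a monomial. [folklore] -/
theorem X_mul_X_eq_monomial (a c : Fin 4) :
    (X a * X c : MvPolynomial (Fin 4) K) = monomial (Finsupp.single a 1 + Finsupp.single c 1) 1 := by
  rw [X, X, monomial_mul, mul_one]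

/-- The coefficient of the linear monomial `x_i` in `(x_i + u) + (x_a + v)(x_c + w)` is `1` when `i ∉ {a, c}`.
[folklore] -/
theorem coeff_single_translate_linear_add_mul {i a c : Fin 4} (hia : i ≠ a) (hic : i ≠ c) (b : Fin 4 → K) :
    coeff (Finsupp.single i 1) (PointBlowup.translate b (X i + X a * X c : MvPolynomial (Fin 4) K)) = 1 := by
  unfold PointBlowup.translate
  simp only [map_add, map_mul, aeval_X]
  have h1 : coeff (Finsupp.single i 1) (X i + C (b i) : MvPolynomial (Fin 4) K) = 1 := by
    rw [coeff_add, coeff_X, if_pos rfl, coeff_C, if_neg (Ne.symm (Finsupp.single_ne_zero.mpr one_ne_zero)),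
      add_zero]
  have hXa : coeff (Finsupp.single i 1) (X a : MvPolynomial (Fin 4) K) = 0 := by
    rw [coeff_X, if_neg]
    exact fun h => hia ((Finsupp.single_left_inj one_ne_zero).mp h).symm
  have hXc : coeff (Finsupp.single i 1) (X c : MvPolynomial (Fin 4) K) = 0 := by
    rw [coeff_X, if_neg]
    exact fun h => hic ((Finsupp.single_left_inj one_ne_zero).mp h).symm
  have h2 : coeff (Finsupp.single i 1) ((X a + C (b a)) * (X c + C (b c)) : MvPolynomial (Fin 4) K) = 0 := by
    have hexp : ((X a + C (b a)) * (X c + C (b c)) : MvPolynomial (Fin 4) K) =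
        X a * X c + C (b c) * X a + C (b a) * X c + C (b a * b c) := by
      rw [map_mul]
      ring
    rw [hexp, coeff_add, coeff_add, coeff_add, coeff_C_mul, coeff_C_mul, hXa, hXc, mul_zero, mul_zero, add_zero,
      add_zero, coeff_C, if_neg (Ne.symm (Finsupp.single_ne_zero.mpr one_ne_zero)), add_zero, X_mul_X_eq_monomial,
      coeff_monomial, if_neg]
    intro h
    have hd := congrArg Finsupp.degree h
    rw [map_add, Finsupp.degree_single, Finsupp.degree_single, Finsupp.degree_single] at hd
    exact absurd hd (by decide)
  rw [coeff_add, h1, h2, add_zero]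

/-- **The chart transform of a quadratic monomial under the point blow-up** (`q = 2`): `x_a x_c ↦ x^{(e_a + e_c) ∖ j}`
(the exponent at `j` drops to `|d| − 2 = 0`). [cite: HauserPerlega2019PRIMS, §2 (the blowup in the x₁-chart)] -/
theorem chartTransform_two_X_mul_X (j a c : Fin 4) :
    CentreBlowup.chartTransform 2 Finset.univ j (X a * X c : MvPolynomial (Fin 4) K) =
      monomial ((Finsupp.single a 1 + Finsupp.single c 1).erase j) 1 := by
  rw [X_mul_X_eq_monomial, CentreBlowup.chartTransform_monomial]
  congr 1
  rw [CentreBlowup.chartExponent, CentreBlowup.degIn_univ, map_add, Finsupp.degree_single,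
    Finsupp.degree_single, Nat.sub_self, Finsupp.update_eq_erase_add_single, Finsupp.single_zero, add_zero]

/-- Erasing a variable not in a quadratic exponent. [folklore] -/
theorem erase_single_add_single_of_ne {j a c : Fin 4} (hja : j ≠ a) (hjc : j ≠ c) :
    (Finsupp.single a 1 + Finsupp.single c 1 : Fin 4 →₀ ℕ).erase j = Finsupp.single a 1 + Finsupp.single c 1 := by
  rw [Finsupp.erase_add, Finsupp.erase_single_ne hja, Finsupp.erase_single_ne hjc]

/-- Erasing the first variable of a quadratic exponent. [folklore] -/
theorem erase_single_add_single_left {a c : Fin 4} (hac : a ≠ c) :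
    (Finsupp.single a 1 + Finsupp.single c 1 : Fin 4 →₀ ℕ).erase a = Finsupp.single c 1 := by
  rw [Finsupp.erase_add, Finsupp.erase_single, Finsupp.erase_single_ne hac, zero_add]

/-- **The chart transforms of `x₁x₂ + x₃x₄`**: in the chart `x_j` the transform is `x_{j'} + (the other product)`, `j'`
the partner of `j`. [cite: HauserPerlega2019PRIMS, §2 (the blowup in the x₁-chart)] -/
theorem chartTransform_quadric (j : Fin 4) :
    ∃ (i a c : Fin 4), i ≠ a ∧ i ≠ c ∧
      CentreBlowup.chartTransform 2 Finset.univ j (X 0 * X 1 + X 2 * X 3 : MvPolynomial (Fin 4) K) =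
        X i + X a * X c := by
  rw [CentreBlowup.chartTransform_add, chartTransform_two_X_mul_X, chartTransform_two_X_mul_X]
  have hj : j = 0 ∨ j = 1 ∨ j = 2 ∨ j = 3 := by fin_cases j <;> simp
  rcases hj with rfl | rfl | rfl | rfl
  · refine ⟨1, 2, 3, by decide, by decide, ?_⟩
    rw [erase_single_add_single_left (show (0 : Fin 4) ≠ 1 by decide),
      erase_single_add_single_of_ne (show (0 : Fin 4) ≠ 2 by decide) (show (0 : Fin 4) ≠ 3 by decide),
      ← X_mul_X_eq_monomial]
    rfl
  · refine ⟨0, 2, 3, by decide, by decide, ?_⟩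
    rw [add_comm (Finsupp.single (0 : Fin 4) 1) (Finsupp.single 1 1),
      erase_single_add_single_left (show (1 : Fin 4) ≠ 0 by decide),
      erase_single_add_single_of_ne (show (1 : Fin 4) ≠ 2 by decide) (show (1 : Fin 4) ≠ 3 by decide),
      ← X_mul_X_eq_monomial]
    rfl
  · refine ⟨3, 0, 1, by decide, by decide, ?_⟩
    rw [erase_single_add_single_of_ne (show (2 : Fin 4) ≠ 0 by decide) (show (2 : Fin 4) ≠ 1 by decide),
      erase_single_add_single_left (show (2 : Fin 4) ≠ 3 by decide), ← X_mul_X_eq_monomial, add_comm]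
    rfl
  · refine ⟨2, 0, 1, by decide, by decide, ?_⟩
    rw [erase_single_add_single_of_ne (show (3 : Fin 4) ≠ 0 by decide) (show (3 : Fin 4) ≠ 1 by decide),
      add_comm (Finsupp.single (2 : Fin 4) 1) (Finsupp.single 3 1),
      erase_single_add_single_left (show (3 : Fin 4) ≠ 2 by decide), ← X_mul_X_eq_monomial, add_comm]
    rfl

/-- **No point of the exceptional divisor is equimultiple for `x₁x₂ + x₃x₄`**: in every chart a linear monomial with
coefficient `1` survives translation. [cite: Hauser2010, §F (equiconstant points)] -/
theorem not_isEquimultiplePoint_quadric [DecidableEq K] (j : Fin 4) (b : Fin 4 → K) (s : State K)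
    (hs : s.F = (X 0 * X 1 + X 2 * X 3 : MvPolynomial (Fin 4) K)) :
    ¬ CentreBlowup.IsEquimultiplePoint 2 Finset.univ j b s := by
  intro h
  obtain ⟨i, a, c, hia, hic, hct⟩ := chartTransform_quadric (K := K) j
  have h1 := h (Finsupp.single i 1) (Finsupp.single_ne_zero.mpr one_ne_zero)
    (by rw [Finsupp.degree_single]; decide)
  rw [CentreBlowup.pointTransform, hs, hct, coeff_single_translate_linear_add_mul hia hic b] at h1
  exact one_ne_zero h1

/-- The linear coefficients of `F(x + b)` for `F = x₁x₂ + x₃x₄`: `x₁ ↦ b₂`, `x₂ ↦ b₁`, `x₃ ↦ b₄`, `x₄ ↦ b₃`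
(here as the partner map `i ↦ i'`). [folklore] -/
theorem coeff_single_translate_quadric (b : Fin 4 → K) {i i' a c : Fin 4} (hii' : i ≠ i') (hia : i ≠ a)
    (hic : i ≠ c)
    (hF : (X 0 * X 1 + X 2 * X 3 : MvPolynomial (Fin 4) K) = X i' * X i + X a * X c) :
    coeff (Finsupp.single i 1) (PointBlowup.translate b (X 0 * X 1 + X 2 * X 3 : MvPolynomial (Fin 4) K)) =
      b i' := by
  rw [hF]
  unfold PointBlowup.translate
  simp only [map_add, map_mul, aeval_X]
  have hXi : coeff (Finsupp.single i 1) (X i : MvPolynomial (Fin 4) K) = 1 := by rw [coeff_X, if_pos rfl]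
  have hX : ∀ {e : Fin 4}, i ≠ e → coeff (Finsupp.single i 1) (X e : MvPolynomial (Fin 4) K) = 0 := by
    intro e hie
    rw [coeff_X, if_neg]
    exact fun h => hie ((Finsupp.single_left_inj one_ne_zero).mp h).symm
  have hC : ∀ u : K, coeff (Finsupp.single i 1) (C u : MvPolynomial (Fin 4) K) = 0 := fun u => by
    rw [coeff_C, if_neg (Ne.symm (Finsupp.single_ne_zero.mpr one_ne_zero))]
  have hXX : ∀ e e' : Fin 4, coeff (Finsupp.single i 1) (X e * X e' : MvPolynomial (Fin 4) K) = 0 := by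
    intro e e'
    rw [X_mul_X_eq_monomial, coeff_monomial, if_neg]
    intro h
    have hd := congrArg Finsupp.degree h
    rw [map_add, Finsupp.degree_single, Finsupp.degree_single, Finsupp.degree_single] at hd
    exact absurd hd (by decide)
  have hexp : ((X i' + C (b i')) * (X i + C (b i)) + (X a + C (b a)) * (X c + C (b c)) : MvPolynomial (Fin 4) K) =
      X i' * X i + C (b i) * X i' + C (b i') * X i + C (b i' * b i) +
        (X a * X c + C (b c) * X a + C (b a) * X c + C (b a * b c)) := by
    rw [map_mul, map_mul]
    ring
  rw [hexp]
  simp only [coeff_add, coeff_C_mul, hXX, hXi, hX hii', hX hia, hX hic, hC, mul_zero, mul_one, add_zero, zero_add]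

/-- **The root parameters of `x₁x₂ + x₃x₄` reduce to `b = 0`.** [folklore] -/
theorem roots_quadric_subset (b : Fin 4 → K)
    (H : ∀ d : Fin 4 →₀ ℕ, d ≠ 0 → d.degree < 2 →
      coeff d (PointBlowup.translate b (X 0 * X 1 + X 2 * X 3 : MvPolynomial (Fin 4) K)) = 0) : b = 0 := by
  have key : ∀ {i i' a c : Fin 4}, i ≠ i' → i ≠ a → i ≠ c →
      (X 0 * X 1 + X 2 * X 3 : MvPolynomial (Fin 4) K) = X i' * X i + X a * X c → b i' = 0 := by
    intro i i' a c hii' hia hic hF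
    rw [← coeff_single_translate_quadric b hii' hia hic hF]
    exact H _ (Finsupp.single_ne_zero.mpr one_ne_zero) (by rw [Finsupp.degree_single]; decide)
  funext i
  fin_cases i
  · exact key (i := 1) (i' := 0) (a := 2) (c := 3) (by decide) (by decide) (by decide) rfl
  · exact key (i := 0) (i' := 1) (a := 2) (c := 3) (by decide) (by decide) (by decide) (by ring)
  · exact key (i := 3) (i' := 2) (a := 0) (c := 1) (by decide) (by decide) (by decide) (by ring)
  · exact key (i := 2) (i' := 3) (a := 0) (c := 1) (by decide) (by decide) (by decide) (by ring)

/-- `x₁x₂ + x₃x₄` is clean for `p = 2` (no monomial is a square). [cite: HauserPerlega2019PRIMS, §2 (cleaning)] -/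
theorem isClean_quadric :
    Literature.Barriers.ResolutionOfSingularities.HauserPerlega.IsClean 2 (X 0 * X 1 + X 2 * X 3 : MvPolynomial (Fin 4) K) := by
  intro d hd hpth
  rw [X_mul_X_eq_monomial, X_mul_X_eq_monomial] at hd
  have hd' := Finset.mem_of_subset (MvPolynomial.support_add) hd
  rw [Finset.mem_union] at hd'
  rcases hd' with hd' | hd'
  · have hd'' := Finset.mem_of_subset (support_monomial_subset) hd'
    rw [Finset.mem_singleton] at hd''
    subst hd''
    have h0 : (Finsupp.single 0 1 + Finsupp.single 1 1 : Fin 4 →₀ ℕ) 0 = 1 := by simp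
    have h := hpth 0 (by rw [Finsupp.mem_support_iff, h0]; exact one_ne_zero)
    rw [h0] at h
    exact absurd h (by decide)
  · have hd'' := Finset.mem_of_subset (support_monomial_subset) hd'
    rw [Finset.mem_singleton] at hd''
    subst hd''
    have h0 : (Finsupp.single 2 1 + Finsupp.single 3 1 : Fin 4 →₀ ℕ) 2 = 1 := by simp
    have h := hpth 2 (by rw [Finsupp.mem_support_iff, h0]; exact one_ne_zero)
    rw [h0] at h
    exact absurd h (by decide)

/-- `x₁x₂ + x₃x₄ ≠ 0`. [folklore] -/
theorem quadric_ne_zero : (X 0 * X 1 + X 2 * X 3 : MvPolynomial (Fin 4) K) ≠ 0 := by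
  intro h
  have hc := congrArg (coeff (Finsupp.single (0 : Fin 4) 1 + Finsupp.single 1 1)) h
  rw [coeff_add, X_mul_X_eq_monomial, X_mul_X_eq_monomial, coeff_monomial, if_pos rfl, coeff_monomial, if_neg,
    coeff_zero, add_zero] at hc
  · exact one_ne_zero hc
  · intro heq
    have := DFunLike.congr_fun heq 0
    simp at this

/-! ## 2. The certificate -/

/-- **THE FOUR-FOLD DOUBLE POINT `z² + x₁x₂ + x₃x₄` (char `2`) ADMITS A MARKED RESOLUTION.** For every algebraically
closed `K` of characteristic `2`, the marked ideal `(𝔸⁵_K, (z² + x₁x₂ + x₃x₄)·𝒪, [], 2)` admits a marked resolution in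
the sense of BGMW Def. 3.1.3 — an unconditional instance of the conclusion of `PIDim4.OrderReduction 2`, obtained from
the walk form `exists_isMarkedResolution_of_walk`: root set `{0}`, no edge out of `(F, 0, ∅)`.
[cite: BierstoneGrigorievMilmanWlodarczyk2011, Def. 3.1.3] [cite: Hauser2010, §F (equiconstant points)] -/
theorem exists_isMarkedResolution_quadric [IsAlgClosed K] [CharP K 2] [DecidableEq K] :
    ∃ (X' : Scheme.{0}) (π : X' ⟶ P 4 K) (M' : MarkedIdeal X'),
      IsMarkedResolution (⟨hypSheaf 2 (X 0 * X 1 + X 2 * X 3 : MvPolynomial (Fin 4) K), [], 2⟩ :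
        MarkedIdeal (P 4 K)) π M' := by
  haveI : Fact (Nat.Prime 2) := ⟨Nat.prime_two⟩
  refine exists_isMarkedResolution_of_walk (p := 2) _ quadric_ne_zero isClean_quadric
    ((Set.finite_singleton (0 : Fin 4 → K)).subset fun b hb => roots_quadric_subset b hb) fun b hb => ?_
  obtain rfl := roots_quadric_subset b hb
  -- the root state is `(F, 0, ∅)`
  have hs : (⟨deletePthPowers 2 (PointBlowup.translate (0 : Fin 4 → K) (X 0 * X 1 + X 2 * X 3)), 0, ∅⟩ :
      State K).F = (X 0 * X 1 + X 2 * X 3 : MvPolynomial (Fin 4) K) := by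
    change deletePthPowers 2 (PointBlowup.translate (0 : Fin 4 → K) (X 0 * X 1 + X 2 * X 3)) = _
    rw [PointBlowup.translate_zero]
    exact Literature.Barriers.ResolutionOfSingularities.HauserPerlega.deletePthPowers_eq_self isClean_quadric
  -- no edge out of it
  have hno : ∀ s' : State K, ¬ Edge 2 Finset.univ
      (⟨deletePthPowers 2 (PointBlowup.translate (0 : Fin 4 → K) (X 0 * X 1 + X 2 * X 3)), 0, ∅⟩ : State K) s' := by
    rintro s' ⟨j, b, -, -, heq, -, -⟩
    exact not_isEquimultiplePoint_quadric j b _ hs heq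
  refine ⟨Acc.intro _ fun s' h => (hno s' h).elim, fun s' hs' => ?_⟩
  -- the only reachable state is the root; its branching set is empty
  have hs' : s' = ⟨deletePthPowers 2 (PointBlowup.translate (0 : Fin 4 → K) (X 0 * X 1 + X 2 * X 3)), 0, ∅⟩ := by
    induction hs' with
    | refl => rfl
    | tail _ hedge ih =>
      subst ih
      exact (hno _ hedge).elim
  subst hs'
  refine (Set.finite_empty).subset fun jb hjb => ?_
  exact not_isEquimultiplePoint_quadric jb.1 jb.2 _ hs hjb.2

end Quadric

end Equimultiple

end Summit.ResolutionOfSingularities.ResolutionOfSingularities.Theorems.PIDim4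

end
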